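import Literature.NumberTheory.ComplexMultiplication.ReflexDegreeImprimitivity
import Literature.NumberTheory.ComplexMultiplication.CMTypeRankOrbitPairing
import HarnessLib

/-!
# Dodson's constant weight criterion (Dodson 1984, §3.1.1) for an ARBITRARY CM field containing an imaginary
# quadratic field: `t(Φ) + [2|f| = n] = r + 1 + [|f| = 0]`

B. Dodson, *The structure of Galois groups of CM-fields*, Trans. AMS **283** (1984) [Dodson1984] (held text
`paper:doi-10-2307-1999987`, pp. 11–12), §3.1.1:

> "The following Theorem will be referred to as the "constant weight criterion" for degeneracy.  THEOREM.  Suppose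
> the CM-field `K` has an imaginary quadratic subfield, and let `G₀ = Gal(K₀ᶜ/ℚ)` be given by `G₀ ⊂ Sₙ`.  Then `G` as
> `Gal(Kᶜ/ℚ)` has the trivial ρ-structure with `v = 1` on `⟨ρ⟩ × G₀`.  Let `Φ = Φᶠ`, `f ∈ (ℤ₂)ⁿ`, be a CM-type on
> `K` and let `r` be the rank of the `ℤ`-span of the orbit `G₀*(f)`, regarded as a subset of `ℤⁿ`.  Then
> `t(Φ) = r + 1`, unless the weight of `f` is `n/2`, in which case `t(Φ) = r` may also occur."

(Proof, p. 12: "the `G`-orbit of `f` is `G₀*(f) ∪ G₀*(ρf)`"; "`t(Φ)` is the rank of the `ℤ`-module spanned by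
`W = {(v, ρv) ∈ ℤ₂²ⁿ | v ∈ G*(f)}`"; a lemma on vectors of constant weight `w`; "the rank of `Φ = Φᶠ` can be `r` if
and only if `(ρ, ρ)` belongs to the `ℤ`-span of the `(v, ρv)`, in which case … `2w = n`".)

`ConstantWeightCriterion.lean` (lit-deligne-3 gen 7) proves the criterion for ABELIAN `K` (Kubota characters).  This
file proves it in the PRINTED generality — `K₀` arbitrary, `G₀ ⊆ Sₙ` any transitive group — in the abstract setting
of the tree's `CMTypeRank.lean` (carrier (W): a group `G` acting transitively on the finite set `E` of embeddings,
`ρ ∈ G` the complex conjugation, `Φ` a CM type, `IsCMTypeWith ρ Φ`, `t(Φ) = typeRank G Φ`):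

* "`K` has an imaginary quadratic subfield `k`" is the block `E₀ ⊆ E` of the embeddings inducing a fixed embedding
  of `k` — itself a CM type (`IsCMTypeWith ρ E₀`, the type INDUCED from `k`) which every `g ∈ G` maps onto `E₀` or
  onto `ρE₀ = E ∖ E₀` (`hG`); `G₀ = Gal(Kᶜ/k) ≅ Gal(K₀ᶜ/ℚ)` is its stabiliser `Stab(E₀)`, of index `2`, and
  `G = G₀ ⊔ ρG₀` (`mem_stabilizer_or`);
* Dodson's `f ∈ (ℤ₂)ⁿ` is the set `f = E₀ ∖ Φ` of positions where `Φ` deviates from `E₀` (so `Φ = (E₀ ∖ f) ⊔ ρf`), its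
  weight is `|f|`, `n = |E₀|`, and "the rank of the `ℤ`-span of the orbit `G₀*(f)` in `ℤⁿ`" is the Kubota–Dodson rank
  `typeRank G₀ f` of `f` under `G₀` (the `ℚ`-dimension of the span of the indicators of its `G₀`-translates).

PROVED (theorems only; no definition, no named fact):

* `IsCMTypeWith.translateInd_eq_of_mem_stabilizer` — for `g ∈ G₀`: `𝟙[gx ∈ Φ] = 𝟙_{E₀}(x) − 𝟙[gx ∈ f] + 𝟙[gρx ∈ f]`
  (Dodson's vectors `(v, ρv)`; `G₀*(ρf)` gives the negatives, `IsCMTypeWith.antiVec_rho_mul` of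
  `CMTypeRankOrbitPairing`);
* `IsCMTypeWith.typeRank_eq_finrank_span_add_one` — `t(Φ) = 1 + dim span{2·𝟙[g · ∈ f] − 𝟙_{E₀} : g ∈ G₀}` (through
  Shimura's `T(φ − φρ)`, `typeRank_eq_finrank_antiSpan_add_one`, and the injective map `F ↦ F∘ρ − F` on functions
  supported on `E₀`);
* **`IsCMTypeWith.typeRank_add_eq_typeRank_stabilizer_add`** — the criterion in the exact form
  `t(Φ) + [2|f| = n] = r + 1 + [|f| = 0]` (the printed lemma on constant weight becomes: `Σ_{g∈G₀} 𝟙[g · ∈ f]` is a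
  NON-ZERO multiple of `𝟙_{E₀}` by transitivity, and the total-mass functional separates `𝟙_{E₀}` from the span of
  the `2·𝟙[g · ∈ f] − 𝟙_{E₀}` exactly when `2|f| = n`);
* `….typeRank_eq_typeRank_stabilizer_add_one` (`|f| ∉ {0, n/2}`: `t = r + 1`), `….typeRank_eq_typeRank_stabilizer`
  (`2|f| = n`: `t = r` — in this formulation the printed "may also occur" is forced), `….typeRank_eq_two_of_subset`
  (`f = ∅`: `Φ = E₀` is the type induced from `k`, `t = 2`); `….smul_eq_or_of_ncard_orbit_eq_two` ("`K` has two
  types having `D` as a reflex field": a type with reflex degree `2` is such a block `E₀`);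
* number fields (Part II; `K` any number field with CM types, `L/ℚ` Galois CM, `Φ₀ Φ : CMType K` read in
  `Hom_ℚ(K, L)`, `[K′(Φ₀) : ℚ] = 2`): **`cmTypeRank_add_eq_typeRank_stabilizer_add`** — Pohlmann's `cmTypeRank Φ`
  (= Dodson's `t(Φ)`, `typeRank_algValuedIn_eq_cmTypeRank`) satisfies `t(Φ) + [2|Φ₀ ∖ Φ| = [K:ℚ]/2] = r + 1 +
  [Φ₀ ⊆ Φ]` with `r` the rank of the `Gal(L/K′(Φ₀))`-translates of `Φ₀ ∖ Φ`; `cmTypeRank_eq_typeRank_stabilizer_add_one`,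
  `cmTypeRank_eq_typeRank_stabilizer`.

## References

* [Dodson1984] B. Dodson, Trans. AMS 283 (1984), §3.1.1 Theorem and proof (pp. 11–12); §3.1.0 (rank, weight).
* [Shimura1998] G. Shimura, *Abelian varieties with complex multiplication and modular functions*, §32.10.
-/

set_option autoImplicit false

open scoped BigOperators Pointwise

namespace Literature.NumberTheory.ComplexMultiplication

section GroupLevel

variable {G : Type*} [Group G] {E : Type*} [MulAction G E] {ρ : G} {Φ E₀ : Set E}

/-! ### Generic tools -/

/-- The total mass of the indicator of a translate: `Σ_x 𝟙[gx ∈ S] = |S|`. [folklore] -/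
private theorem sum_translateInd_eq [Fintype E] (S : Set E) (g : G) : ∑ x, translateInd S g x = (S.ncard : ℚ) := by
  classical
  have h1 : ∑ x, translateInd S g x = ((Finset.univ.filter fun x : E => g • x ∈ S).card : ℚ) := by
    rw [Finset.card_filter, Nat.cast_sum]
    refine Finset.sum_congr rfl fun x _ => ?_
    by_cases hx : g • x ∈ S
    · rw [translateInd_of_mem hx, if_pos hx, Nat.cast_one]
    · rw [translateInd_of_not_mem hx, if_neg hx, Nat.cast_zero]
  have h2 : (Finset.univ.filter fun x : E => g • x ∈ S).card = S.toFinset.card := by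
    refine Finset.card_bij (fun x _ => g • x) (fun x hx => ?_) (fun x _ y _ hxy => MulAction.injective g hxy)
      (fun y hy => ⟨g⁻¹ • y, ?_, smul_inv_smul g y⟩)
    · rw [Set.mem_toFinset]
      exact (Finset.mem_filter.1 hx).2
    · rw [Finset.mem_filter, smul_inv_smul]
      exact ⟨Finset.mem_univ _, Set.mem_toFinset.1 hy⟩
  rw [h1, h2, Set.ncard_eq_toFinset_card']

/-- A linear functional-free form of "the total mass vanishes on a span if it vanishes on the generators".
[folklore] -/
private theorem sum_apply_eq_zero_of_mem_span [Fintype E] {T : Set (E → ℚ)} (hT : ∀ v ∈ T, ∑ x, v x = 0)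
    {v : E → ℚ} (hv : v ∈ Submodule.span ℚ T) : ∑ x, v x = 0 := by
  induction hv using Submodule.span_induction with
  | mem v hv => exact hT v hv
  | zero => simp
  | add v w _ _ hv hw => simp only [Pi.add_apply, Finset.sum_add_distrib, hv, hw, add_zero]
  | smul a v _ hv => simp only [Pi.smul_apply, smul_eq_mul, ← Finset.mul_sum, hv, mul_zero]

/-- Functions in a span vanish wherever all generators vanish. [folklore] -/
private theorem apply_eq_zero_of_mem_span {T : Set (E → ℚ)} {x : E} (hT : ∀ v ∈ T, v x = 0) {v : E → ℚ}
    (hv : v ∈ Submodule.span ℚ T) : v x = 0 := by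
  have : Submodule.span ℚ T ≤ LinearMap.ker (LinearMap.proj (R := ℚ) (φ := fun _ : E => ℚ) x) :=
    Submodule.span_le.2 fun w hw => by
      rw [SetLike.mem_coe, LinearMap.mem_ker, LinearMap.proj_apply]
      exact hT w hw
  have hx := this hv
  rwa [LinearMap.mem_ker, LinearMap.proj_apply] at hx

namespace IsCMTypeWith

/-! ### The block `E₀` of an imaginary quadratic subfield -/

/-- `ρ⁻¹` acts as `ρ`. [folklore] -/
private theorem rho_inv_smul (h₀ : IsCMTypeWith ρ E₀) (y : E) : ρ⁻¹ • y = ρ • y :=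
  inv_smul_eq_iff.2 (h₀.invol y).symm

/-- `G = G₀ ⊔ ρG₀`: every `g` stabilises the block `E₀` or `ρg` does ("the trivial `ρ`-structure with `v = 1` on
`⟨ρ⟩ × G₀`"). [cite: Dodson1984, §3.1.1 Theorem (proof)] -/
theorem mem_stabilizer_or (h₀ : IsCMTypeWith ρ E₀) (hG : ∀ g : G, g • E₀ = E₀ ∨ g • E₀ = ρ • E₀) (g : G) :
    g ∈ MulAction.stabilizer G E₀ ∨ ρ * g ∈ MulAction.stabilizer G E₀ := by
  rcases hG g with h1 | h1
  · exact Or.inl h1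
  · right
    rw [MulAction.mem_stabilizer_iff, mul_smul, h1]
    ext x
    simp only [Set.mem_smul_set_iff_inv_smul_mem, h₀.rho_inv_smul, h₀.invol]

/-- An element of `G₀ = Stab(E₀)` preserves membership in the block. [folklore] -/
private theorem smul_mem_iff_of_mem_stabilizer' {m : G}
    (hm : m ∈ MulAction.stabilizer G E₀) (x : E) : m • x ∈ E₀ ↔ x ∈ E₀ := by
  have hmE : m • E₀ = E₀ := hm
  constructor
  · intro hx
    rw [← hmE, Set.smul_mem_smul_set_iff] at hx
    exact hx
  · intro hx
    rw [← hmE]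
    exact Set.smul_mem_smul_set hx

/-- `G₀` is transitive on the block `E₀` (as `G` is transitive on `E` and `gE₀ ∈ {E₀, ρE₀}`). [folklore] -/
private theorem exists_mem_stabilizer_smul_eq [MulAction.IsPretransitive G E] (h₀ : IsCMTypeWith ρ E₀)
    (hG : ∀ g : G, g • E₀ = E₀ ∨ g • E₀ = ρ • E₀) {x y : E} (hx : x ∈ E₀) (hy : y ∈ E₀) :
    ∃ m ∈ MulAction.stabilizer G E₀, m • x = y := by
  obtain ⟨g, rfl⟩ := MulAction.exists_smul_eq G x y
  refine ⟨g, ?_, rfl⟩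
  rcases hG g with h1 | h1
  · exact h1
  · exfalso
    have hgx : g • x ∈ ρ • E₀ := by
      rw [← h1]
      exact Set.smul_mem_smul_set hx
    obtain ⟨z, hz, hzx⟩ := hgx
    have hzx' : ρ • z = g • x := hzx
    rw [← hzx'] at hy
    exact (h₀.mem_iff z).1 hz hy

/-! ### Dodson's vectors `(v, ρv)`: the translates of `Φ` by `G₀` in terms of the translates of `f = E₀ ∖ Φ` -/

/-- **`Φᵍ = (E₀ ∖ fᵍ) ⊔ ρfᵍ` for `g ∈ G₀`** — on indicators: `𝟙[gx ∈ Φ] = 𝟙_{E₀}(x) − 𝟙[gx ∈ f] + 𝟙[g(ρx) ∈ f]` with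
`f = E₀ ∖ Φ` (Dodson's "type given by `f ∈ (ℤ₂)ⁿ`", the pair `(v, ρv)`). [cite: Dodson1984, §3.1.1 Theorem (proof); §1.2 Proposition] -/
theorem translateInd_eq_of_mem_stabilizer (h : IsCMTypeWith ρ Φ) (h₀ : IsCMTypeWith ρ E₀) {m : G}
    (hm : m ∈ MulAction.stabilizer G E₀) (x : E) :
    translateInd Φ m x =
      translateInd E₀ (1 : G) x - translateInd (E₀ \ Φ) m x + translateInd (E₀ \ Φ) m (ρ • x) := by
  by_cases hx : x ∈ E₀
  · have hc : translateInd E₀ (1 : G) x = 1 := translateInd_of_mem (by rwa [one_smul])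
    have hmx : m • x ∈ E₀ := (smul_mem_iff_of_mem_stabilizer' hm x).2 hx
    have hρ : translateInd (E₀ \ Φ) m (ρ • x) = 0 := by
      apply translateInd_of_not_mem
      intro hmem
      rw [h₀.comm] at hmem
      exact (h₀.mem_iff _).1 hmx hmem.1
    rw [hc, hρ, add_zero]
    by_cases hΦ : m • x ∈ Φ
    · rw [translateInd_of_mem hΦ, translateInd_of_not_mem (show m • x ∉ E₀ \ Φ from fun hd => hd.2 hΦ)]
      norm_num
    · rw [translateInd_of_not_mem hΦ, translateInd_of_mem (show m • x ∈ E₀ \ Φ from ⟨hmx, hΦ⟩)]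
      norm_num
  · have hc : translateInd E₀ (1 : G) x = 0 := translateInd_of_not_mem (by rwa [one_smul])
    have hmx : m • x ∉ E₀ := fun hmx => hx ((smul_mem_iff_of_mem_stabilizer' hm x).1 hmx)
    have ha : translateInd (E₀ \ Φ) m x = 0 :=
      translateInd_of_not_mem (show m • x ∉ E₀ \ Φ from fun hd => hmx hd.1)
    have hρx : ρ • x ∈ E₀ := (h₀.rho_smul_mem_iff x).2 hx
    have hmρx : m • ρ • x ∈ E₀ := (smul_mem_iff_of_mem_stabilizer' hm _).2 hρx
    rw [hc, ha, sub_zero, zero_add]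
    by_cases hΦ : m • x ∈ Φ
    · rw [translateInd_of_mem hΦ, translateInd_of_mem]
      refine ⟨hmρx, ?_⟩
      rw [h.comm]
      exact (h.mem_iff _).1 hΦ
    · rw [translateInd_of_not_mem hΦ, translateInd_of_not_mem]
      rintro ⟨-, hmem⟩
      apply hmem
      rw [h.comm]
      exact (h.rho_smul_mem_iff _).2 hΦ

/-- Shimura's `±1`-vector of the translate by `g ∈ G₀` is `F∘ρ − F` for `F = 2·𝟙[g · ∈ f] − 𝟙_{E₀}` (a function
supported on the block). [cite: Dodson1984, §3.1.1 Theorem (proof)] -/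
theorem antiVec_eq_of_mem_stabilizer (h : IsCMTypeWith ρ Φ) (h₀ : IsCMTypeWith ρ E₀) {m : G}
    (hm : m ∈ MulAction.stabilizer G E₀) (x : E) :
    antiVec Φ m x = (2 * translateInd (E₀ \ Φ) m (ρ • x) - translateInd E₀ (1 : G) (ρ • x)) -
      (2 * translateInd (E₀ \ Φ) m x - translateInd E₀ (1 : G) x) := by
  have h1 := h.translateInd_eq_of_mem_stabilizer h₀ hm x
  have h2 := h₀.translateInd_rho_smul (1 : G) x
  simp only [antiVec, h1, h2]
  ring

/-! ### `t(Φ) = 1 + dim span{2·𝟙[g · ∈ f] − 𝟙_{E₀} : g ∈ G₀}` -/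

/-- The generators `2·𝟙[g · ∈ f] − 𝟙_{E₀}` (`g ∈ G₀`) — hence their span — vanish off the block `E₀`. [folklore] -/
private theorem apply_eq_zero_of_not_mem {v : E → ℚ}
    (hv : v ∈ Submodule.span ℚ (Set.range fun m : MulAction.stabilizer G E₀ =>
      (2 : ℚ) • translateInd (E₀ \ Φ) (m : G) - translateInd E₀ (1 : G)))
    {x : E} (hx : x ∉ E₀) : v x = 0 := by
  refine apply_eq_zero_of_mem_span (fun w hw => ?_) hv
  obtain ⟨m, rfl⟩ := hw
  have hmx : (m : G) • x ∉ E₀ := fun hmx => hx ((smul_mem_iff_of_mem_stabilizer' m.2 x).1 hmx)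
  have h1 : translateInd (E₀ \ Φ) (m : G) x = 0 :=
    translateInd_of_not_mem (show (m : G) • x ∉ E₀ \ Φ from fun hd => hmx hd.1)
  have h2 : translateInd E₀ (1 : G) x = 0 := translateInd_of_not_mem (show (1 : G) • x ∉ E₀ by rwa [one_smul])
  simp only [Pi.sub_apply, Pi.smul_apply, smul_eq_mul, h1, h2, mul_zero, sub_zero]

/-- **`T(φ − φρ) ⊗ ℚ` is the image of `span{2·𝟙[g · ∈ f] − 𝟙_{E₀} : g ∈ G₀}` under `F ↦ F∘ρ − F`.**
[cite: Dodson1984, §3.1.1 Theorem (proof)] -/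
theorem antiSpan_eq_map (h : IsCMTypeWith ρ Φ) (h₀ : IsCMTypeWith ρ E₀)
    (hG : ∀ g : G, g • E₀ = E₀ ∨ g • E₀ = ρ • E₀) :
    antiSpan G Φ =
      (Submodule.span ℚ (Set.range fun m : MulAction.stabilizer G E₀ =>
        (2 : ℚ) • translateInd (E₀ \ Φ) (m : G) - translateInd E₀ (1 : G))).map
      (LinearMap.funLeft ℚ ℚ (fun x : E => ρ • x) - LinearMap.id : (E → ℚ) →ₗ[ℚ] (E → ℚ)) := by
  set L : (E → ℚ) →ₗ[ℚ] (E → ℚ) := LinearMap.funLeft ℚ ℚ (fun x : E => ρ • x) - LinearMap.id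
  have hLapp : ∀ (F : E → ℚ) (x : E), L F x = F (ρ • x) - F x := fun F x => rfl
  have hgen : ∀ m : MulAction.stabilizer G E₀,
      antiVec Φ (m : G) = L ((2 : ℚ) • translateInd (E₀ \ Φ) (m : G) - translateInd E₀ (1 : G)) := by
    intro m
    funext x
    rw [hLapp, h.antiVec_eq_of_mem_stabilizer h₀ m.2 x]
    simp only [Pi.sub_apply, Pi.smul_apply, smul_eq_mul]
  apply le_antisymm
  · refine Submodule.span_le.2 ?_
    rintro _ ⟨g, rfl⟩
    dsimp only
    rcases h₀.mem_stabilizer_or hG g with hg | hg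
    · rw [SetLike.mem_coe, show antiVec Φ g = antiVec Φ ((⟨g, hg⟩ : MulAction.stabilizer G E₀) : G) from rfl,
        hgen]
      exact Submodule.mem_map_of_mem (Submodule.subset_span ⟨⟨g, hg⟩, rfl⟩)
    · have hneg : antiVec Φ g = -antiVec Φ (ρ * g) := by
        rw [h.antiVec_rho_mul, neg_neg]
      rw [SetLike.mem_coe, hneg,
        show antiVec Φ (ρ * g) = antiVec Φ ((⟨ρ * g, hg⟩ : MulAction.stabilizer G E₀) : G) from rfl, hgen,
        ← map_neg]
      exact Submodule.mem_map_of_mem (Submodule.neg_mem _ (Submodule.subset_span ⟨⟨ρ * g, hg⟩, rfl⟩))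
  · rw [Submodule.map_le_iff_le_comap]
    refine Submodule.span_le.2 ?_
    rintro _ ⟨m, rfl⟩
    dsimp only
    rw [SetLike.mem_coe, Submodule.mem_comap, ← hgen]
    exact Submodule.subset_span ⟨(m : G), rfl⟩

/-- `F ↦ F∘ρ − F` is injective on the functions supported on the block (`E₀ ∩ ρE₀ = ∅`). [folklore] -/
private theorem eq_zero_of_map_eq_zero (h₀ : IsCMTypeWith ρ E₀) {v : E → ℚ}
    (hv : v ∈ Submodule.span ℚ (Set.range fun m : MulAction.stabilizer G E₀ =>
      (2 : ℚ) • translateInd (E₀ \ Φ) (m : G) - translateInd E₀ (1 : G)))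
    (hLv : (LinearMap.funLeft ℚ ℚ (fun x : E => ρ • x) - LinearMap.id : (E → ℚ) →ₗ[ℚ] (E → ℚ)) v = 0) :
    v = 0 := by
  funext x
  by_cases hx : x ∈ E₀
  · have h1 : v (ρ • x) - v x = 0 := congrFun hLv x
    have h2 : v (ρ • x) = 0 := apply_eq_zero_of_not_mem hv ((h₀.mem_iff x).1 hx)
    rw [h2, zero_sub, neg_eq_zero] at h1
    exact h1
  · exact apply_eq_zero_of_not_mem hv hx

/-- **`t(Φ) = 1 + dim span{2·𝟙[g · ∈ f] − 𝟙_{E₀} : g ∈ G₀}`** ("`t(Φ)` is the rank of the `ℤ`-module spanned by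
`W = {(v, ρv) | v ∈ G*(f)}`", reduced to the block). [cite: Dodson1984, §3.1.1 Theorem (proof)] -/
theorem typeRank_eq_finrank_span_add_one [Fintype E] [Nonempty E] (h : IsCMTypeWith ρ Φ)
    (h₀ : IsCMTypeWith ρ E₀) (hG : ∀ g : G, g • E₀ = E₀ ∨ g • E₀ = ρ • E₀) :
    typeRank G Φ =
      Module.finrank ℚ (Submodule.span ℚ (Set.range fun m : MulAction.stabilizer G E₀ =>
        (2 : ℚ) • translateInd (E₀ \ Φ) (m : G) - translateInd E₀ (1 : G))) + 1 := by
  set M := Submodule.span ℚ (Set.range fun m : MulAction.stabilizer G E₀ =>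
    (2 : ℚ) • translateInd (E₀ \ Φ) (m : G) - translateInd E₀ (1 : G))
  set L : (E → ℚ) →ₗ[ℚ] (E → ℚ) := LinearMap.funLeft ℚ ℚ (fun x : E => ρ • x) - LinearMap.id
  rw [h.typeRank_eq_finrank_antiSpan_add_one, h.antiSpan_eq_map h₀ hG]
  congr 1
  -- `L` is injective on `M`: rank–nullity for `L|_M`
  have hker : LinearMap.ker (L.domRestrict M) = ⊥ := by
    rw [LinearMap.ker_eq_bot']
    rintro ⟨v, hv⟩ hv0
    exact Subtype.ext (h₀.eq_zero_of_map_eq_zero hv hv0)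
  have hrn := LinearMap.finrank_range_add_finrank_ker (L.domRestrict M)
  rw [hker, finrank_bot, add_zero, LinearMap.range_domRestrict] at hrn
  exact hrn

/-! ### The rank `r` of the `G₀`-translates of `f` and the sum over `G₀` -/

/-- Dodson's `r` in the tree's vocabulary: `typeRank G₀ f = dim span{𝟙[g · ∈ f] : g ∈ G₀}` (as functions on all
of `E`; they are supported on `E₀`). [cite: Dodson1984, §3.1.1 Theorem] -/
theorem typeRank_stabilizer_eq (S : Set E) :
    typeRank (MulAction.stabilizer G E₀) S =
      Module.finrank ℚ (Submodule.span ℚ (Set.range fun m : MulAction.stabilizer G E₀ =>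
        translateInd S (m : G))) := rfl

/-- **The criterion, exact form: `t(Φ) + [2|f| = n] = r + 1 + [|f| = 0]`** (`n = |E₀|`, `f = E₀ ∖ Φ`,
`r = typeRank G₀ f`, `G₀ = Stab(E₀)`).  Printed: "`t(Φ) = r + 1`, unless the weight of `f` is `n/2`, in which case
`t(Φ) = r` may also occur" (here: does occur); the weight `|f| = 0` (`Φ = E₀`, the type induced from the
imaginary quadratic subfield, `t = 2`, `r = 0`) is tacitly excluded by the printed formula.
[cite: Dodson1984, §3.1.1 Theorem] -/
theorem typeRank_add_eq_typeRank_stabilizer_add [Fintype E] [Nonempty E] [Finite G]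
    [MulAction.IsPretransitive G E] [Decidable (E₀ ⊆ Φ)]
    (h : IsCMTypeWith ρ Φ) (h₀ : IsCMTypeWith ρ E₀) (hG : ∀ g : G, g • E₀ = E₀ ∨ g • E₀ = ρ • E₀) :
    typeRank G Φ + (if 2 * (E₀ \ Φ).ncard = E₀.ncard then 1 else 0) =
      typeRank (MulAction.stabilizer G E₀) (E₀ \ Φ) + 1 + (if E₀ ⊆ Φ then 1 else 0) := by
  classical
  -- notation
  set G₀ := MulAction.stabilizer G E₀
  haveI : Fintype G₀ := Fintype.ofFinite G₀
  set f : Set E := E₀ \ Φ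
  set a : G₀ → E → ℚ := fun m => translateInd f (m : G) with ha
  set c : E → ℚ := translateInd E₀ (1 : G) with hc
  set M := Submodule.span ℚ (Set.range fun m : G₀ => (2 : ℚ) • a m - c)
  set R := Submodule.span ℚ (Set.range a) with hR
  have ht : typeRank G Φ = Module.finrank ℚ M + 1 := h.typeRank_eq_finrank_span_add_one h₀ hG
  have hr : typeRank G₀ f = Module.finrank ℚ R := typeRank_stabilizer_eq f
  -- the block and the weight
  set n : ℕ := E₀.ncard with hn
  set k : ℕ := f.ncard with hk
  have hcx : ∀ x, c x = if x ∈ E₀ then 1 else 0 := fun x => by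
    by_cases hx : x ∈ E₀
    · rw [if_pos hx]; exact translateInd_of_mem (by rwa [one_smul])
    · rw [if_neg hx]; exact translateInd_of_not_mem (by rwa [one_smul])
  obtain ⟨x₀, hx₀⟩ : E₀.Nonempty := by
    obtain ⟨x⟩ := ‹Nonempty E›
    by_cases hx : x ∈ E₀
    · exact ⟨x, hx⟩
    · exact ⟨ρ • x, (h₀.rho_smul_mem_iff x).2 hx⟩
  have hn0 : n ≠ 0 := by
    rw [hn, Ne, Set.ncard_eq_zero]
    exact Set.nonempty_iff_ne_empty.1 ⟨x₀, hx₀⟩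
  have hc0 : c ≠ 0 := fun h0 => by
    have := congrFun h0 x₀
    rw [hcx, if_pos hx₀] at this
    exact one_ne_zero this
  have hsum_c : ∑ x, c x = n := by rw [hc, sum_translateInd_eq]
  have hsum_a : ∀ m : G₀, ∑ x, a m x = k := fun m => by rw [ha]; exact sum_translateInd_eq f (m : G)
  have hkf : k ≤ n := Set.ncard_le_ncard Set.sdiff_subset
  -- Case `f = ∅`: `Φ ⊇ E₀` (so `Φ = E₀`), `r = 0`, `t = 2`
  by_cases hsub : E₀ ⊆ Φ
  · have hf0 : f = ∅ := Set.sdiff_eq_empty.2 hsub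
    have hk0 : k = 0 := by rw [hk, hf0, Set.ncard_empty]
    have ha0 : ∀ m : G₀, a m = 0 := fun m => by
      funext x
      rw [ha]
      exact translateInd_of_not_mem (by rw [hf0]; exact Set.notMem_empty _)
    have hR0 : R = ⊥ := by
      rw [hR, Submodule.span_eq_bot]
      rintro _ ⟨m, rfl⟩
      exact ha0 m
    have hM1 : M = ℚ ∙ c := by
      apply le_antisymm
      · refine Submodule.span_le.2 ?_
        rintro _ ⟨m, rfl⟩
        dsimp only
        rw [ha0, smul_zero, zero_sub, SetLike.mem_coe]
        exact Submodule.neg_mem _ (Submodule.mem_span_singleton_self c)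
      · rw [Submodule.span_singleton_le_iff_mem]
        have hmem : -((2 : ℚ) • a ⟨1, G₀.one_mem⟩ - c) ∈ M :=
          Submodule.neg_mem _ (Submodule.subset_span ⟨⟨1, G₀.one_mem⟩, rfl⟩)
        rwa [ha0, smul_zero, zero_sub, neg_neg] at hmem
    rw [if_pos hsub, if_neg (by omega), ht, hr, hR0, hM1, finrank_bot, finrank_span_singleton hc0]
  -- Case `f ≠ ∅`
  have hk0 : k ≠ 0 := by
    rw [hk, Ne, Set.ncard_eq_zero, Set.sdiff_eq_empty]
    exact hsub
  rw [if_neg hsub, add_zero]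
  -- `s = Σ_{g ∈ G₀} 𝟙[g · ∈ f]` is `G₀`-invariant, hence constant on `E₀` (transitivity) and zero off `E₀`
  set s : E → ℚ := ∑ m : G₀, a m with hs
  have hsR : s ∈ R := Submodule.sum_mem _ fun m _ => Submodule.subset_span ⟨m, rfl⟩
  have hs_apply : ∀ x, s x = ∑ m : G₀, a m x := fun x => by rw [hs, Finset.sum_apply]
  have hs_inv : ∀ (g : G₀) (x : E), s ((g : G) • x) = s x := by
    intro g x
    rw [hs_apply, hs_apply]
    refine Fintype.sum_equiv (Equiv.mulRight g) _ _ fun m => ?_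
    simp only [ha, Equiv.coe_mulRight, Subgroup.coe_mul, translateInd_mul]
  have hs_off : ∀ x, x ∉ E₀ → s x = 0 := by
    intro x hx
    rw [hs_apply]
    refine Finset.sum_eq_zero fun m _ => ?_
    have hmx : (m : G) • x ∉ E₀ := fun hmx => hx ((smul_mem_iff_of_mem_stabilizer' m.2 x).1 hmx)
    exact translateInd_of_not_mem (fun hd => hmx hd.1)
  set lam : ℚ := s x₀
  have hs_eq : s = lam • c := by
    funext x
    rw [Pi.smul_apply, hcx, smul_eq_mul]
    by_cases hx : x ∈ E₀
    · rw [if_pos hx, mul_one]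
      obtain ⟨m, hm, hmx⟩ := h₀.exists_mem_stabilizer_smul_eq hG hx₀ hx
      rw [← hmx]
      exact hs_inv ⟨m, hm⟩ x₀
    · rw [if_neg hx, mul_zero]
      exact hs_off x hx
  -- total mass: `λ n = |G₀| k`, so `λ ≠ 0`
  have hmass : lam * n = Fintype.card G₀ * k := by
    have h1 : ∑ x, s x = lam * n := by
      rw [hs_eq]
      simp only [Pi.smul_apply, smul_eq_mul, ← Finset.mul_sum, hsum_c]
    have h2 : ∑ x, s x = Fintype.card G₀ * k := by
      simp only [hs_apply]
      rw [Finset.sum_comm]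
      simp only [hsum_a, Finset.sum_const, Finset.card_univ, nsmul_eq_mul]
    rw [← h1, h2]
  have hlam0 : lam ≠ 0 := by
    intro h0
    rw [h0, zero_mul] at hmass
    have : (Fintype.card G₀ : ℚ) * k ≠ 0 := mul_ne_zero (Nat.cast_ne_zero.2 Fintype.card_ne_zero)
      (Nat.cast_ne_zero.2 hk0)
    exact this hmass.symm
  -- `c ∈ R`, `R = M + ℚc`
  have hcR : c ∈ R := by
    have : c = lam⁻¹ • s := by rw [hs_eq, smul_smul, inv_mul_cancel₀ hlam0, one_smul]
    rw [this]
    exact Submodule.smul_mem _ _ hsR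
  have hMR : M ≤ R := by
    refine Submodule.span_le.2 ?_
    rintro _ ⟨m, rfl⟩
    dsimp only
    exact Submodule.sub_mem _ (Submodule.smul_mem _ _ (Submodule.subset_span ⟨m, rfl⟩)) hcR
  have hRsup : R = M ⊔ ℚ ∙ c := by
    apply le_antisymm
    · refine Submodule.span_le.2 ?_
      rintro _ ⟨m, rfl⟩
      have : a m = (1 / 2 : ℚ) • ((2 : ℚ) • a m - c) + (1 / 2 : ℚ) • c := by
        rw [smul_sub, smul_smul]; norm_num
      rw [SetLike.mem_coe, this]
      exact Submodule.add_mem _ (Submodule.mem_sup_left (Submodule.smul_mem _ _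
        (Submodule.subset_span ⟨m, rfl⟩))) (Submodule.mem_sup_right (Submodule.smul_mem _ _
          (Submodule.mem_span_singleton_self c)))
    · exact sup_le hMR ((Submodule.span_singleton_le_iff_mem _ _).2 hcR)
  -- `c ∈ M ↔ 2k ≠ n`
  have hcM : c ∈ M ↔ 2 * k ≠ n := by
    constructor
    · intro hcM h2k
      -- every element of `M` has total mass `0` when `2k = n`, but `c` has mass `n ≠ 0`
      have hgen : ∀ v ∈ Set.range (fun m : G₀ => (2 : ℚ) • a m - c), ∑ x, v x = 0 := by
        rintro _ ⟨m, rfl⟩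
        simp only [Pi.sub_apply, Pi.smul_apply, smul_eq_mul, Finset.sum_sub_distrib, ← Finset.mul_sum,
          hsum_a, hsum_c]
        have : (2 : ℚ) * k = n := by exact_mod_cast h2k
        rw [this, sub_self]
      have := sum_apply_eq_zero_of_mem_span hgen hcM
      rw [hsum_c] at this
      exact hn0 (by exact_mod_cast this)
    · intro h2k
      -- `Σ_m (2 a_m − c) = 2s − |G₀| c = (2λ − |G₀|) c` with `2λ − |G₀| ≠ 0`
      have hsumM : ∑ m : G₀, ((2 : ℚ) • a m - c) ∈ M :=
        Submodule.sum_mem _ fun m _ => Submodule.subset_span ⟨m, rfl⟩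
      have hval : ∑ m : G₀, ((2 : ℚ) • a m - c) = (2 * lam - Fintype.card G₀) • c := by
        rw [Finset.sum_sub_distrib, ← Finset.smul_sum, Finset.sum_const, Finset.card_univ, ← hs, hs_eq,
          smul_smul, sub_smul, ← Nat.cast_smul_eq_nsmul ℚ]
      have hcoef : (2 * lam - Fintype.card G₀ : ℚ) ≠ 0 := by
        intro h0
        have h1 : (Fintype.card G₀ : ℚ) = 2 * lam := by linarith
        have h2 : lam * n = lam * (2 * k) := by rw [hmass, h1]; ring
        have h3 : (n : ℚ) = 2 * k := mul_left_cancel₀ hlam0 h2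
        exact h2k (by exact_mod_cast h3.symm)
      have : c = (2 * lam - Fintype.card G₀ : ℚ)⁻¹ • ∑ m : G₀, ((2 : ℚ) • a m - c) := by
        rw [hval, smul_smul, inv_mul_cancel₀ hcoef, one_smul]
      rw [this]
      exact Submodule.smul_mem _ _ hsumM
  -- dimension count: `dim R = dim M + 1 − [c ∈ M]`
  have hdim := Submodule.finrank_sup_add_finrank_inf_eq M (ℚ ∙ c)
  rw [← hRsup, finrank_span_singleton hc0] at hdim
  by_cases h2k : 2 * k = n
  · -- `c ∉ M`: `M ⊓ ℚc = ⊥`, `r = dim M + 1 = t`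
    have hcM' : c ∉ M := fun hc' => (hcM.1 hc') h2k
    have hinf : M ⊓ (ℚ ∙ c) = ⊥ := by
      rw [eq_bot_iff]
      intro v hv
      rw [Submodule.mem_inf, Submodule.mem_span_singleton] at hv
      obtain ⟨hvM, μ, rfl⟩ := hv
      by_cases hμ : μ = 0
      · rw [hμ, zero_smul]
        exact Submodule.zero_mem _
      · exfalso
        apply hcM'
        have := M.smul_mem μ⁻¹ hvM
        rwa [smul_smul, inv_mul_cancel₀ hμ, one_smul] at this
    rw [hinf, finrank_bot, add_zero] at hdim
    rw [if_pos h2k, ht, hr, hdim]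
  · -- `c ∈ M`: `M ⊓ ℚc = ℚc`, `r = dim M = t − 1`
    have hcM' : c ∈ M := hcM.2 h2k
    have hinf : M ⊓ (ℚ ∙ c) = ℚ ∙ c := inf_eq_right.2 ((Submodule.span_singleton_le_iff_mem _ _).2 hcM')
    rw [hinf, finrank_span_singleton hc0, Nat.add_right_cancel_iff] at hdim
    rw [if_neg h2k, add_zero, ht, hr, hdim]

/-- **`t(Φ) = r + 1`** when the weight `|f|` is neither `0` nor `n/2`. [cite: Dodson1984, §3.1.1 Theorem] -/
theorem typeRank_eq_typeRank_stabilizer_add_one [Fintype E] [Nonempty E] [Finite G]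
    [MulAction.IsPretransitive G E]
    (h : IsCMTypeWith ρ Φ) (h₀ : IsCMTypeWith ρ E₀) (hG : ∀ g : G, g • E₀ = E₀ ∨ g • E₀ = ρ • E₀)
    (hw : 2 * (E₀ \ Φ).ncard ≠ E₀.ncard) (hw0 : ¬ E₀ ⊆ Φ) :
    typeRank G Φ = typeRank (MulAction.stabilizer G E₀) (E₀ \ Φ) + 1 := by
  classical
  have := h.typeRank_add_eq_typeRank_stabilizer_add h₀ hG
  rwa [if_neg hw, if_neg hw0, add_zero, add_zero] at this

/-- **`t(Φ) = r`** when the weight is `n/2` ("in which case `t(Φ) = r` may also occur" — with `r` the rank of the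
`G₀`-translates of `f` it does occur). [cite: Dodson1984, §3.1.1 Theorem] -/
theorem typeRank_eq_typeRank_stabilizer [Fintype E] [Nonempty E] [Finite G] [MulAction.IsPretransitive G E]
    (h : IsCMTypeWith ρ Φ) (h₀ : IsCMTypeWith ρ E₀) (hG : ∀ g : G, g • E₀ = E₀ ∨ g • E₀ = ρ • E₀)
    (hw : 2 * (E₀ \ Φ).ncard = E₀.ncard) :
    typeRank G Φ = typeRank (MulAction.stabilizer G E₀) (E₀ \ Φ) := by
  classical
  have hE : E₀.ncard ≠ 0 := by
    obtain ⟨x⟩ := ‹Nonempty E›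
    have hne : E₀.Nonempty := by
      by_cases hx : x ∈ E₀
      · exact ⟨x, hx⟩
      · exact ⟨ρ • x, (h₀.rho_smul_mem_iff x).2 hx⟩
    rw [Ne, Set.ncard_eq_zero]
    exact Set.nonempty_iff_ne_empty.1 hne
  have hw0 : ¬ E₀ ⊆ Φ := fun hsub => by
    rw [Set.sdiff_eq_empty.2 hsub, Set.ncard_empty, mul_zero] at hw
    exact hE hw.symm
  have := h.typeRank_add_eq_typeRank_stabilizer_add h₀ hG
  rw [if_pos hw, if_neg hw0, add_zero] at this
  omega

/-- **The type induced from the imaginary quadratic subfield has rank `2`**: `f = ∅`, i.e. `Φ ⊇ E₀` (then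
`Φ = E₀`), gives `t(Φ) = 2` (`r = 0`; the reflex field is `k`). [cite: Dodson1984, §3.1.1 Theorem (proof: "K has
two types having D as a reflex field")] -/
theorem typeRank_eq_two_of_subset [Fintype E] [Nonempty E] [Finite G] [MulAction.IsPretransitive G E]
    (h : IsCMTypeWith ρ Φ) (h₀ : IsCMTypeWith ρ E₀) (hG : ∀ g : G, g • E₀ = E₀ ∨ g • E₀ = ρ • E₀)
    (hsub : E₀ ⊆ Φ) : typeRank G Φ = 2 := by
  classical
  have hE : E₀.ncard ≠ 0 := by
    obtain ⟨x⟩ := ‹Nonempty E›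
    have hne : E₀.Nonempty := by
      by_cases hx : x ∈ E₀
      · exact ⟨x, hx⟩
      · exact ⟨ρ • x, (h₀.rho_smul_mem_iff x).2 hx⟩
    rw [Ne, Set.ncard_eq_zero]
    exact Set.nonempty_iff_ne_empty.1 hne
  have h0 : (E₀ \ Φ) = ∅ := Set.sdiff_eq_empty.2 hsub
  have hr : typeRank (MulAction.stabilizer G E₀) (E₀ \ Φ) = 0 := by
    rw [typeRank_stabilizer_eq, h0]
    have : Submodule.span ℚ (Set.range fun m : MulAction.stabilizer G E₀ => translateInd (∅ : Set E) (m : G)) = ⊥ := by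
      rw [Submodule.span_eq_bot]
      rintro _ ⟨m, rfl⟩
      funext x
      exact translateInd_of_not_mem (Set.notMem_empty _)
    rw [this, finrank_bot]
  have := h.typeRank_add_eq_typeRank_stabilizer_add h₀ hG
  rw [hr, h0, Set.ncard_empty, mul_zero, if_neg (Ne.symm hE), if_pos hsub, add_zero] at this
  omega

/-- "`K` has two types having `D` as a reflex field of degree `2`": a CM type `E₀` whose orbit has TWO elements
(reflex degree `2`) is mapped by every `g` onto `E₀` or onto `ρE₀`. [cite: Dodson1984, §3.1.1 Theorem (proof)] -/
theorem smul_eq_or_of_ncard_orbit_eq_two [Nonempty E] (h₀ : IsCMTypeWith ρ E₀)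
    (h2 : (MulAction.orbit G E₀).ncard = 2) (g : G) : g • E₀ = E₀ ∨ g • E₀ = ρ • E₀ := by
  obtain ⟨x, y, _, hxy⟩ := Set.ncard_eq_two.1 h2
  have hmem : ∀ S ∈ MulAction.orbit G E₀, S = x ∨ S = y := fun S hS => by
    rw [hxy] at hS
    simpa using hS
  have hne : ρ • E₀ ≠ E₀ := by
    obtain ⟨z⟩ := ‹Nonempty E›
    intro heq
    have h1 : ρ • z ∈ E₀ ↔ z ∈ E₀ := by
      constructor
      · intro hz
        rw [← heq, Set.smul_mem_smul_set_iff] at hz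
        exact hz
      · intro hz
        rw [← heq]
        exact Set.smul_mem_smul_set hz
    by_cases hz : z ∈ E₀
    · exact (h₀.mem_iff z).1 hz (h1.2 hz)
    · exact hz (h1.1 ((h₀.rho_smul_mem_iff z).2 hz))
  by_cases hg1 : g • E₀ = E₀
  · exact Or.inl hg1
  · right
    rcases hmem _ (MulAction.mem_orbit_self E₀) with h1 | h1 <;>
      rcases hmem _ (MulAction.mem_orbit E₀ ρ) with h2' | h2' <;>
        rcases hmem _ (MulAction.mem_orbit E₀ g) with h3 | h3
    all_goals
      first
      | exact h3.trans h2'.symm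
      | exact absurd (h3.trans h1.symm) hg1
      | exact absurd (h2'.trans h1.symm) hne

end IsCMTypeWith

end GroupLevel

/-! ## Part II — CM fields containing an imaginary quadratic field

For a CM field `K`, `L/ℚ` Galois CM receiving `K` (`j : K →ₐ[ℚ] L`), complex CM types `Φ₀, Φ : CMType K` read in
`Hom_ℚ(K, L)` through `ι : L → ℂ` (`algValuedIn`), and `Φ₀` a type whose reflex field is (imaginary) quadratic —
"`K` has an imaginary quadratic subfield `D`" and `Φ₀` is one of the "two types having `D` as a reflex field"
(the type induced from `D`) — Dodson's criterion computes Pohlmann's `cmTypeRank Φ` from the rank `r` of the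
`Gal(L/D)`-translates of `f = Φ₀ ∖ Φ` (`G₀ = Gal(Kᶜ/D) = Stab(Φ₀) ≅ Gal(K₀ᶜ/ℚ)`). -/

section NumberField

open NumberField IntermediateField
open Literature.AlgebraicGeometry.Motives (CMType)
open Literature.AlgebraicGeometry.Pohlmann1968 (cmTypeRank)

variable {K : Type} [Field K] [NumberField K]
variable {L : Type} [Field L] [NumberField L] [IsCMField L] [IsGalois ℚ L]

/-- **Dodson's constant weight criterion for a CM field with an imaginary quadratic subfield** (`K₀` arbitrary):
`Rank(Φ) + [2|f| = n] = r + 1 + [|f| = 0]`, where `Φ₀` is a CM type of `K` with quadratic reflex field `D`,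
`f = Φ₀ ∖ Φ`, `n = [K : ℚ]/2`, and `r` is the rank of the `Gal(L/D)`-translates of `f` (read in `Hom_ℚ(K, L)`).
[cite: Dodson1984, §3.1.1 Theorem] -/
theorem cmTypeRank_add_eq_typeRank_stabilizer_add (j : K →ₐ[ℚ] L) (ι : L →+* ℂ) (Φ₀ Φ : CMType K)
    (h2 : Module.finrank ℚ (reflexField ℚ L (algValuedIn ι Φ₀.1)) = 2) [Decidable (Φ₀.1 ⊆ Φ.1)] :
    cmTypeRank Φ + (if 2 * (Φ₀.1 \ Φ.1).ncard = Module.finrank ℚ K / 2 then 1 else 0) =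
      typeRank (MulAction.stabilizer (L ≃ₐ[ℚ] L) (algValuedIn ι Φ₀.1))
          (algValuedIn ι Φ₀.1 \ algValuedIn ι Φ.1) + 1 + (if Φ₀.1 ⊆ Φ.1 then 1 else 0) := by
  classical
  haveI : Nonempty (K →ₐ[ℚ] L) := ⟨j⟩
  have h₀ := isCMTypeWith_conjGal_algValuedIn ι Φ₀
  have h := isCMTypeWith_conjGal_algValuedIn ι Φ
  have horb : (MulAction.orbit (L ≃ₐ[ℚ] L) (algValuedIn ι Φ₀.1)).ncard = 2 := by
    rw [← Nat.card_coe_set_eq, ← finrank_reflexField_eq_card_orbit, h2]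
  have hG : ∀ g : L ≃ₐ[ℚ] L, g • algValuedIn ι Φ₀.1 = algValuedIn ι Φ₀.1 ∨
      g • algValuedIn ι Φ₀.1 = (conjGal : L ≃ₐ[ℚ] L) • algValuedIn ι Φ₀.1 :=
    h₀.smul_eq_or_of_ncard_orbit_eq_two horb
  have key := h.typeRank_add_eq_typeRank_stabilizer_add h₀ hG
  have hk : (algValuedIn ι Φ₀.1 \ algValuedIn ι Φ.1).ncard = (Φ₀.1 \ Φ.1).ncard := by
    rw [show algValuedIn ι Φ₀.1 \ algValuedIn ι Φ.1 = algValuedIn ι (Φ₀.1 \ Φ.1) from rfl,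
      ncard_algValuedIn j ι]
  have hn : (algValuedIn ι Φ₀.1).ncard = Module.finrank ℚ K / 2 := by
    rw [ncard_algValuedIn j ι]
    have := Literature.AlgebraicGeometry.Motives.HodgeStructure.two_mul_ncard_cmType_eq_finrank Φ₀
    omega
  have hsub : algValuedIn ι Φ₀.1 ⊆ algValuedIn ι Φ.1 ↔ Φ₀.1 ⊆ Φ.1 := by
    constructor
    · intro hs τ hτ
      obtain ⟨χ, rfl⟩ := (algHomEquivRingHomOfNormal j ι).surjective τ
      exact hs hτ
    · intro hs χ hχ
      exact hs hχ
  rw [hk, hn, typeRank_algValuedIn_eq_cmTypeRank j ι Φ] at key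
  by_cases hs : Φ₀.1 ⊆ Φ.1
  · rw [if_pos (hsub.2 hs)] at key
    rw [if_pos hs]
    exact key
  · rw [if_neg (fun h' => hs (hsub.1 h'))] at key
    rw [if_neg hs]
    exact key

/-- `Rank(Φ) = r + 1` when the weight `|Φ₀ ∖ Φ|` is neither `0` nor `n/2`. [cite: Dodson1984, §3.1.1 Theorem] -/
theorem cmTypeRank_eq_typeRank_stabilizer_add_one (j : K →ₐ[ℚ] L) (ι : L →+* ℂ) (Φ₀ Φ : CMType K)
    (h2 : Module.finrank ℚ (reflexField ℚ L (algValuedIn ι Φ₀.1)) = 2)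
    (hw : 2 * (Φ₀.1 \ Φ.1).ncard ≠ Module.finrank ℚ K / 2) (hw0 : ¬ Φ₀.1 ⊆ Φ.1) :
    cmTypeRank Φ =
      typeRank (MulAction.stabilizer (L ≃ₐ[ℚ] L) (algValuedIn ι Φ₀.1))
        (algValuedIn ι Φ₀.1 \ algValuedIn ι Φ.1) + 1 := by
  classical
  have := cmTypeRank_add_eq_typeRank_stabilizer_add j ι Φ₀ Φ h2
  rwa [if_neg hw, if_neg hw0, add_zero, add_zero] at this

/-- `Rank(Φ) = r` when the weight is `n/2` ("in which case `t(Φ) = r` may also occur").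
[cite: Dodson1984, §3.1.1 Theorem] -/
theorem cmTypeRank_eq_typeRank_stabilizer (j : K →ₐ[ℚ] L) (ι : L →+* ℂ) (Φ₀ Φ : CMType K)
    (h2 : Module.finrank ℚ (reflexField ℚ L (algValuedIn ι Φ₀.1)) = 2)
    (hw : 2 * (Φ₀.1 \ Φ.1).ncard = Module.finrank ℚ K / 2) :
    cmTypeRank Φ =
      typeRank (MulAction.stabilizer (L ≃ₐ[ℚ] L) (algValuedIn ι Φ₀.1))
        (algValuedIn ι Φ₀.1 \ algValuedIn ι Φ.1) := by
  classical
  have hn : Module.finrank ℚ K / 2 ≠ 0 := by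
    have := Literature.AlgebraicGeometry.Motives.HodgeStructure.two_mul_ncard_cmType_eq_finrank Φ₀
    have hpos : 0 < Module.finrank ℚ K := Module.finrank_pos
    omega
  have hw0 : ¬ Φ₀.1 ⊆ Φ.1 := fun hsub => by
    rw [Set.sdiff_eq_empty.2 hsub, Set.ncard_empty, mul_zero] at hw
    exact hn hw.symm
  have := cmTypeRank_add_eq_typeRank_stabilizer_add j ι Φ₀ Φ h2
  rw [if_pos hw, if_neg hw0, add_zero] at this
  omega

end NumberField

end Literature.NumberTheory.ComplexMultiplication
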